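import Summits.BirchSwinnertonDyer.BirchSwinnertonDyer.Theorems.ManinLocalTwoThreeUDCGlueTwo
import Summits.BirchSwinnertonDyer.BirchSwinnertonDyer.Theorems.ManinLocalTwoThreeSqRootWitnessHolBInvB
import Summits.BirchSwinnertonDyer.BirchSwinnertonDyer.Theorems.ManinLocalTwoThreeSqRootMinimalDictionary
import Summits.BirchSwinnertonDyer.BirchSwinnertonDyer.Theorems.ManinLocalTwoThreeSqRootMinimalIntegral
import Summits.BirchSwinnertonDyer.BirchSwinnertonDyer.Theorems.ManinLocalTwoThreeKummerMinimalParamPresentation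
import Summits.BirchSwinnertonDyer.BirchSwinnertonDyer.Theorems.ManinLocalTwoThreeIntegralQSeriesNearCuspB
import Summits.BirchSwinnertonDyer.BirchSwinnertonDyer.Theorems.ManinLocalTwoThreeShimuraQuotientHeckeAtFour
import Summits.BirchSwinnertonDyer.BirchSwinnertonDyer.Theorems.ManinLocalTwoThreeShimuraQuotientLevelInstances
import Summits.BirchSwinnertonDyer.Rank1Residual.ManinAdditive.UDCKummerWitnessLineHolds
import HarnessLib

/-!
# THE ℓ = 2 WITNESS LAW (AN2₂) IS A THEOREM — hence `2 ∣ c₀ ⟹ Λ₁(f) ≠ Λ₀(f)` modulo CDT ALONE, and C2 ON THE LOCUS `{∞,0}_f ∈ Λ₀(f)` ⊇ {ROOT NUMBER −1}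
# FOR CURVES WITH A RATIONAL `2`-TORSION POINT modulo the four PRINTED facts CDT, F★, F♮, CES
(route `ManinLocalTwoThree`, deciding crux C2 `ManinOddAtFour` stmt-BirchSwinnertonDyer-22967; cell bsd-f2-manin, prover p2 gen 19; LEAD-MEMO v35 §3 «v24 design,
reducible branch: the UDC LINE AT ℓ = 2»; `--supports stmt-BirchSwinnertonDyer-22967`)

ASSEMBLY of p2 g19's ℓ = 2 witness pieces on the B-line architecture of -an g38 / p2 g17 / the C3 LEAD:
(INT₂) `MinimalSqRoot.exists_int_minimalSqRoot` → (DICT₂) `SqRootWitness.sqRootMinimalDictionary` → (RATB) `ParamPoleJ.kummerMinimalParamPresentation_holds`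
(p3, T-free) → (HOLB₂) `SqRootWitness.sqRootWitnessExtensionB` → (QEXNB) `IntegralQSeries.integralQSeriesNearCuspB_holds` (LEAD, generic) → (INVB₂)
`SqRootWitness.sqRootWitnessInvarianceB` → (QXP) `qExpansionExtensionPrinciple_holds` (LEAD, generic):
* §1 **`sqRootWitnessLaw`** — EXACTLY the inline binder `hWL` of p2's `…UDCGlueTwo`: for a globally minimal `W`, a datum `D` with the lattice clause at a level
  `4 ∣ N`, a rational `2`-division root `e`, a half-period `p` of it (`p ∉ Λ`, `2p = m₁ω₁ + m₂ω₂`, `x_s(T) = c²℘(p)`), THE germ `z` and a `2`-adically integral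
  normalised square root `h` of `Ξ_T`, there are a weight `k` and a holomorphic `F : ℍ → ℂ` with algebraic-integer (indeed integer) `q`-expansion on `ℍ`,
  exponential growth (indeed boundedness) at every cusp, and `Γ₀(N)`-stabiliser EXACTLY the period group of `V_{p, m₁η₁+m₂η₂}` — the witness is
  `F = κ·B_d·(t_W∘φ)·V(c·E_f)` in weight `12m`.
* §2 **`periodLatticeGamma1_ne_of_two_dvd_of_UDW` / `…_of_CDT_algInt`** — for a globally minimal `W` with a rational `2`-torsion point and a LATTICE-OPTIMAL
  `X₀(N)`-datum at `4 ∣ N`: **`2 ∣ c ⟹ Λ₁(f) ≠ Λ₀(f)`**, modulo Unbounded Denominators (resp. the printed CDT fact) ONLY.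
* §3 **`not_two_dvd_maninConstant_of_modularSymbol_zero_mem_of_CDT_of_print`**, **`…_of_rootNumber_eq_neg_one_…`** — **C2 (`2 ∤ c`) on the locus
  `{∞,0}_f ∈ Λ₀(f)`, in particular for ROOT NUMBER `−1` (odd analytic rank) at the conductor level, for every optimal curve with `4 ∣ N` and a rational
  `2`-torsion point — modulo CDT ∧ F★ ∧ F♮ ∧ CES**, all four PRINTED statement-only facts (Calegari–Dimitrov–Tang 2025 Thm 1.0.1; CES 2003 §6.1.2;
  Stevens 1982 Thm 1.3.1(b); CES 2003 Thm 1.1.3 / Stevens 1989 Thm 1.9).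
* §4 **`not_two_dvd_maninConstant_of_periodLatticeGamma1_eq_of_CDT`** and the level instances `…_of_four_dvd_of_odd_sq_dvd_of_CDT` (`4 ∣ N`, odd `q² ∣ N`),
  `…_four_mul_prime_pow_of_CDT` (`N = 4q^e`, `q ≡ 3 (4)`): where `Λ₁ = Λ₀` is an UNCONDITIONAL tree theorem, C2 for curves with a rational `2`-torsion
  point holds modulo CDT ALONE (no cusp facts).
HONEST FRAMING.  This closes LEAD-MEMO v35 §3's «UDC line at ℓ = 2» in the kernel: on locus A ∩ {reducible} C2 ⟸ print.  It says NOTHING about the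
IRREDUCIBLE case (no rational `2`-torsion: F♯'s business), nor about locus B (`{∞,0}_f ∉ Λ₀(f)`: analytic rank `0`, even-order cuspidal point), where C2's
v23 laws 6a‴/6b-res/6♭‴ live; CDT, F★, F♮, CES are NOT proved in the tree; C2 as stated, Manin's conjecture and BSD are NOT proved.  No definitions, no sorry.
[cite: CalegariDimitrovTang2025, Thm. 1.0.1 and Remarks 58–59] [cite: KurthLong2008, Prop. 18] [cite: Stevens1982, Thm. 1.3.1] [cite: Stevens1989, Thm. 1.9 and §2]
[cite: ConradEdixhovenStein2003, §6.1.2 and Thm. 1.1.3] [cite: AtkinLehner1970, Thm. 3]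
-/

set_option autoImplicit false
-- lint-debt: the directory name repeats the summit name (sibling precedent `ManinLocalTwoThreeUDCGlueTwo.lean`)
set_option linter.dupNamespace false

noncomputable section

open PowerSeries CongruenceSubgroup Complex
open scoped MatrixGroups ModularForm Manifold PeriodPair
open WeierstrassCurve Literature.NumberTheory.EllipticCurves Literature.NumberTheory.EllipticCurves.ModularForms
open Summit.BirchSwinnertonDyer.Rank1Residual.ManinAdditive
open Summit.BirchSwinnertonDyer.Rank1Residual.ManinAdditive.CuspidalKummer
open Summit.BirchSwinnertonDyer.Rank1Residual.ManinAdditive.UDCKummerLineK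
open Summit.BirchSwinnertonDyer.Rank1Residual.ManinAdditive.UDCKummerWitnessLine
open Summit.BirchSwinnertonDyer.BirchSwinnertonDyer.Theorems.ManinLocalTwoThree.SigmaSquareRoot
open Summit.BirchSwinnertonDyer.BirchSwinnertonDyer.Theorems.ManinLocalTwoThree.SigmaHabitat
open Summit.BirchSwinnertonDyer.BirchSwinnertonDyer.Theorems.ManinLocalTwoThree.SqRootWitness
open Summit.BirchSwinnertonDyer.BirchSwinnertonDyer.Theorems.ManinLocalTwoThree.MinimalSqRoot
open Summit.BirchSwinnertonDyer.BirchSwinnertonDyer.Theorems.ManinLocalTwoThree.IntegralQSeries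

namespace Summit.BirchSwinnertonDyer.BirchSwinnertonDyer.Theorems.ManinLocalTwoThree.UDCTwo

/-! ## §1 The witness law AN2₂ -/

/-- **AN2₂ — the ℓ = 2 Kummer witness law, PROVED.**  Exactly the binder `hWL` of `…UDCGlueTwo`: the witness is `F = κ·B_d·(t_W∘φ)·V_{p,e}(c·E_f)` in weight
`12m` ((INT₂) → (DICT₂) → (RATB) → (HOLB₂) → (QEXNB) → (INVB₂) → (QXP)).  The lattice clause and `4 ∣ N` are used only through (INT₂) (`e ∈ ℤ`).
[folklore] [cite: KurthLong2008, Def. 16 (type II; shape)] -/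
theorem sqRootWitnessLaw : ∀ (W : WeierstrassCurve ℚ) [W.IsElliptic] [W.IsGloballyMinimal] {N : ℕ} [NeZero N]
    (D : ModularParametrizationData W N) (a : ℕ → ℤ), (∀ n, (a n : ℂ) = cuspCoeff D.f n) → 4 ∣ N →
    (∀ z ∈ D.L.lattice, ∃ w ∈ periodLattice D.f, z = D.c * w) →
    ∀ e : ℚ, W.twoTorsionPolynomial.toPoly.IsRoot e →
    ∀ (p : ℂ) (m₁ m₂ : ℤ), p ∉ D.L.lattice → 2 * p = m₁ * D.L.ω₁ + m₂ * D.L.ω₂ →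
    ((shortRoot W D.c e : ℚ) : ℂ) = (D.c : ℂ) ^ 2 * ℘[D.L] p →
    ∀ z : ℚ⟦X⟧, IsParamGerm W D.c a z →
    ∀ h : ℚ⟦X⟧, h ^ 2 = kummerSeries W D.c e z → constantCoeff h = 1 → (∀ n : ℕ, ¬ (2 ∣ (coeff n h).den)) →
    ∃ (k : ℤ) (F : UpperHalfPlane → ℂ), MDifferentiable 𝓘(ℂ) 𝓘(ℂ) F ∧
      (∀ γ : Gamma0 N, (∀ w : ℂ, sigmaSqRoot D.L p (m₁ * D.L.η₁ + m₂ * D.L.η₂) (w + (D.c : ℂ) * cuspSymbol D.f γ) =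
        sigmaSqRoot D.L p (m₁ * D.L.η₁ + m₂ * D.L.η₂) w) → F ∣[k] (γ : SL(2, ℤ)) = F) ∧
      (∀ γ : Gamma0 N, F ∣[k] (γ : SL(2, ℤ)) = F → ∀ w : ℂ,
        sigmaSqRoot D.L p (m₁ * D.L.η₁ + m₂ * D.L.η₂) (w + (D.c : ℂ) * cuspSymbol D.f γ) =
          sigmaSqRoot D.L p (m₁ * D.L.η₁ + m₂ * D.L.η₂) w) ∧
      (∀ g : SL(2, ℤ), ∃ C A m : ℝ, ∀ τ : UpperHalfPlane, A ≤ τ.im → ‖(F ∣[k] g) τ‖ ≤ C * Real.exp (m * τ.im)) ∧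
      (∃ b : ℕ → ℂ, (∀ n, IsIntegral ℤ (b n)) ∧ ∀ τ : UpperHalfPlane,
        HasSum (fun n : ℕ ↦ b n * Complex.exp (2 * Real.pi * Complex.I * (τ : ℂ) * n)) (F τ)) := by
  intro W _ _ N _ D a ha h4 _hopt e he p m₁ m₂ hpΛ h2p hX z hz h hh2 hh0 hint
  -- (INT₂)
  obtain ⟨g, hgint, _hg0, hgrel, -⟩ := exists_int_minimalSqRoot W D a ha h4 e he z hz h hh2 hh0 hint
  -- (DICT₂)
  obtain ⟨κ, hκ, B, hB⟩ := sqRootMinimalDictionary W D a ha e hpΛ h2p hX z hz h hh2 hh0 g hgrel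
  -- (RATB)
  obtain ⟨m, Bn, Bd, bd, hBd0, hbd, hid⟩ := ParamPoleJ.kummerMinimalParamPresentation_holds W D a ha
  -- (HOLB₂)
  obtain ⟨F, hFd, hFeq, hFgr⟩ := sqRootWitnessExtensionB D p (m₁ * D.L.η₁ + m₂ * D.L.η₂) m Bn Bd hid κ
  -- (QEXNB) + (QXP)
  obtain ⟨b, B', hbB'⟩ := integralQSeriesNearCuspB_holds
    (fun τ ↦ κ * (minimalParam D τ * sigmaSqRoot D.L p (m₁ * D.L.η₁ + m₂ * D.L.η₂) ((D.c : ℂ) * eichlerIntegral D.f τ))) F Bd g bd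
    hgint ⟨B, fun τ hτ ↦ (hB τ hτ).2.2⟩ hbd ⟨B, fun τ hτ ↦ by rw [hFeq τ (hB τ hτ).1 (hB τ hτ).2.1]; ring⟩
  have hq := UDCKummerWitnessLine.qExpansionExtensionPrinciple_holds F hFd (fun n ↦ (b n : ℂ)) B' hbB'
  -- (INVB₂) and packaging
  refine ⟨12 * (m : ℤ), F, hFd, fun γ hγ ↦ (sqRootWitnessInvarianceB D hpΛ _ hBd0 hκ hFd hFeq γ).1 hγ,
    fun γ hγ ↦ (sqRootWitnessInvarianceB D hpΛ _ hBd0 hκ hFd hFeq γ).2 hγ, hFgr,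
    ⟨fun n ↦ (b n : ℂ), fun n ↦ ?_, hq⟩⟩
  exact isIntegral_algebraMap (R := ℤ) (A := ℂ) (x := b n)

/-! ## §2 `2 ∣ c ⟹ Λ₁(f) ≠ Λ₀(f)` modulo Unbounded Denominators / CDT alone -/

/-- **An even Manin constant forces a non-trivial Shimura `2`-quotient**, modulo Unbounded Denominators (all weights, algebraic-integer coefficients): for a
globally minimal `W` with a rational `2`-torsion point and a lattice-optimal `X₀(N)`-datum `D` at a level `4 ∣ N`, `2 ∣ c ⟹ Λ₁(f) ≠ Λ₀(f)`.
CONDITIONAL on `hUDW` only. [cite: CalegariDimitrovTang2025, Thm. 1.0.1] [cite: KurthLong2008, Prop. 18] -/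
theorem periodLatticeGamma1_ne_of_two_dvd_of_UDW (hUDW : ∀ k : ℤ, UnboundedDenominatorsWeightAlgInt k)
    (W : WeierstrassCurve ℚ) [W.IsElliptic] [W.IsGloballyMinimal] {N : ℕ} [NeZero N] (D : ModularParametrizationData W N) (h4 : 4 ∣ N)
    (hopt : ∀ z ∈ D.L.lattice, ∃ w ∈ periodLattice D.f, z = D.c * w) {e : ℚ} (he : W.twoTorsionPolynomial.toPoly.IsRoot e)
    (h2c : (2 : ℤ) ∣ D.c) : periodLatticeGamma1 D.f ≠ periodLattice D.f :=
  periodLatticeGamma1_ne_of_two_dvd_of_sqRootWitnessLaw sqRootWitnessLaw hUDW W D h4 hopt he h2c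

/-- **`2 ∣ c ⟹ Λ₁(f) ≠ Λ₀(f)` modulo the printed Calegari–Dimitrov–Tang fact** (algebraic-integer form, unbundled by p2 g18).  CONDITIONAL on that
fact only. [cite: CalegariDimitrovTang2025, Thm. 1.0.1 and Remarks 58–59] -/
theorem periodLatticeGamma1_ne_of_two_dvd_of_CDT_algInt
    (hCDT : Literature.NumberTheory.Automorphic.CalegariDimitrovTang2025_unboundedDenominators_algInt)
    (W : WeierstrassCurve ℚ) [W.IsElliptic] [W.IsGloballyMinimal] {N : ℕ} [NeZero N] (D : ModularParametrizationData W N) (h4 : 4 ∣ N)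
    (hopt : ∀ z ∈ D.L.lattice, ∃ w ∈ periodLattice D.f, z = D.c * w) {e : ℚ} (he : W.twoTorsionPolynomial.toPoly.IsRoot e)
    (h2c : (2 : ℤ) ∣ D.c) : periodLatticeGamma1 D.f ≠ periodLattice D.f :=
  periodLatticeGamma1_ne_of_two_dvd_of_UDW (KLine.unboundedDenominatorsWeightAlgInt_of_CDT_algInt' hCDT) W D h4 hopt he h2c

/-! ## §3 C2 on the locus `{∞,0}_f ∈ Λ₀(f)` ⊇ {root number −1}, reducible case, modulo CDT ∧ F★ ∧ F♮ ∧ CES -/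

/-- **C2 (`2 ∤ c`) ON THE LOCUS `{∞,0}_f ∈ Λ₀(f)` for optimal curves with `4 ∣ N` and a rational `2`-torsion point, modulo CDT ∧ F★ ∧ F♮ ∧ CES** (all PRINTED).
[cite: CalegariDimitrovTang2025, Thm. 1.0.1] [cite: Stevens1982, Thm. 1.3.1] [cite: ConradEdixhovenStein2003, §6.1.2, Thm. 1.1.3] [cite: Stevens1989, §2] -/
theorem not_two_dvd_maninConstant_of_modularSymbol_zero_mem_of_CDT_of_print
    (hCDT : Literature.NumberTheory.Automorphic.CalegariDimitrovTang2025_unboundedDenominators_algInt)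
    (hF : optimalGamma1Parametrization_cusp_rational) (hFnat : optimalGamma1Parametrization_cuspZero_galoisConjugate)
    (hCES : exists_optimal_gamma1ParametrizationData)
    (W : WeierstrassCurve ℚ) [W.IsElliptic] [W.IsGloballyMinimal] {N : ℕ} [NeZero N] (D : ModularParametrizationData W N) (h4 : 4 ∣ N)
    (hopt : ∀ z ∈ D.L.lattice, ∃ w ∈ periodLattice D.f, z = D.c * w) {e : ℚ} (he : W.twoTorsionPolynomial.toPoly.IsRoot e)
    (h0 : modularSymbol D.f 0 ∈ periodLattice D.f) : ¬ (2 : ℤ) ∣ D.c :=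
  not_two_dvd_maninConstant_of_modularSymbol_zero_mem_of_sqRootWitnessLaw_of_print sqRootWitnessLaw hCDT hF hFnat hCES W D h4 hopt he h0

/-- **C2 (`2 ∤ c`) FOR ROOT NUMBER `−1` (odd analytic rank), at the conductor level, for optimal curves with `4 ∣ N_W` and a rational `2`-torsion point, modulo
CDT ∧ F★ ∧ F♮ ∧ CES** (all PRINTED). [cite: CalegariDimitrovTang2025, Thm. 1.0.1] [cite: AtkinLehner1970, Thm. 3] [cite: Stevens1989, §2]
[cite: ConradEdixhovenStein2003, Thm. 1.1.3] [cite: Stevens1982, Thm. 1.3.1] -/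
theorem not_two_dvd_maninConstant_of_rootNumber_eq_neg_one_of_CDT_of_print
    (hCDT : Literature.NumberTheory.Automorphic.CalegariDimitrovTang2025_unboundedDenominators_algInt)
    (hF : optimalGamma1Parametrization_cusp_rational) (hFnat : optimalGamma1Parametrization_cuspZero_galoisConjugate)
    (hCES : exists_optimal_gamma1ParametrizationData)
    (W : WeierstrassCurve ℚ) [W.IsElliptic] [W.IsGloballyMinimal] [NeZero (W.conductorNorm ℤ)] (h4 : 4 ∣ W.conductorNorm ℤ)
    (hw : W.rootNumber = -1) (D : ModularParametrizationData W (W.conductorNorm ℤ))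
    (hopt : ∀ z ∈ D.L.lattice, ∃ w ∈ periodLattice D.f, z = D.c * w) {e : ℚ} (he : W.twoTorsionPolynomial.toPoly.IsRoot e) :
    ¬ (2 : ℤ) ∣ D.c :=
  not_two_dvd_maninConstant_of_rootNumber_eq_neg_one_of_sqRootWitnessLaw_of_print sqRootWitnessLaw hCDT hF hFnat hCES W h4 hw D hopt he

/-! ## §4 C2 modulo CDT ALONE where `Λ₁(f) = Λ₀(f)` is an unconditional tree theorem -/

/-- **`Λ₁(f) = Λ₀(f)` ∧ rational `2`-torsion ∧ `4 ∣ N` ⟹ `2 ∤ c`, modulo CDT alone** (lattice-optimal datum of a globally minimal curve).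
CONDITIONAL on the printed CDT fact only. [cite: CalegariDimitrovTang2025, Thm. 1.0.1] -/
theorem not_two_dvd_maninConstant_of_periodLatticeGamma1_eq_of_CDT
    (hCDT : Literature.NumberTheory.Automorphic.CalegariDimitrovTang2025_unboundedDenominators_algInt)
    (W : WeierstrassCurve ℚ) [W.IsElliptic] [W.IsGloballyMinimal] {N : ℕ} [NeZero N] (D : ModularParametrizationData W N) (h4 : 4 ∣ N)
    (hopt : ∀ z ∈ D.L.lattice, ∃ w ∈ periodLattice D.f, z = D.c * w) {e : ℚ} (he : W.twoTorsionPolynomial.toPoly.IsRoot e)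
    (hΛ : periodLatticeGamma1 D.f = periodLattice D.f) : ¬ (2 : ℤ) ∣ D.c := fun h2c ↦
  periodLatticeGamma1_ne_of_two_dvd_of_CDT_algInt hCDT W D h4 hopt he h2c hΛ

/-- **C2 modulo CDT alone at the levels `4 ∣ N`, `q² ∣ N` (`q` an odd prime)** for optimal curves with a rational `2`-torsion point: there `Λ₁(f) = Λ₀(f)`
unconditionally (LEAD's `periodLatticeGamma1_eq_of_four_dvd_of_odd_sq_dvd`: `U_q = q` on the Shimura quotient, `a_q = 0`).
[cite: CalegariDimitrovTang2025, Thm. 1.0.1] [cite: LingOesterle1991, Thm. 1 and Thm. 6] -/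
theorem not_two_dvd_maninConstant_of_four_dvd_of_odd_sq_dvd_of_CDT
    (hCDT : Literature.NumberTheory.Automorphic.CalegariDimitrovTang2025_unboundedDenominators_algInt)
    (W : WeierstrassCurve ℚ) [W.IsElliptic] [W.IsGloballyMinimal] {N : ℕ} [NeZero N] (D : ModularParametrizationData W N) (h4 : 4 ∣ N)
    {q : ℕ} (hq : q.Prime) (hq2 : q ≠ 2) (hsq : q ^ 2 ∣ N)
    (hopt : ∀ z ∈ D.L.lattice, ∃ w ∈ periodLattice D.f, z = D.c * w) {e : ℚ} (he : W.twoTorsionPolynomial.toPoly.IsRoot e) :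
    ¬ (2 : ℤ) ∣ D.c :=
  not_two_dvd_maninConstant_of_periodLatticeGamma1_eq_of_CDT hCDT W D h4 hopt he
    (periodLatticeGamma1_eq_of_four_dvd_of_odd_sq_dvd D (by simpa using h4) hq hq2 hsq)

/-- **C2 modulo CDT alone at `N = 4q^e`, `q ≡ 3 (mod 4)` prime, `e ≥ 1`** for optimal curves with a rational `2`-torsion point: there `Λ₁(f) = Λ₀(f)`
unconditionally (LEAD's `periodLatticeGamma1_eq_of_four_mul_prime_pow`: `(ℤ/2q^e)ˣ/{±1}` has odd order).
[cite: CalegariDimitrovTang2025, Thm. 1.0.1] [cite: LingOesterle1991, Thm. 1 and Thm. 6] -/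
theorem not_two_dvd_maninConstant_four_mul_prime_pow_of_CDT
    (hCDT : Literature.NumberTheory.Automorphic.CalegariDimitrovTang2025_unboundedDenominators_algInt)
    (W : WeierstrassCurve ℚ) [W.IsElliptic] [W.IsGloballyMinimal] {N : ℕ} [NeZero N] {q k : ℕ} (hq : q.Prime) (hq3 : q % 4 = 3) (hk : k ≠ 0)
    (hN : N = 4 * q ^ k) (D : ModularParametrizationData W N)
    (hopt : ∀ z ∈ D.L.lattice, ∃ w ∈ periodLattice D.f, z = D.c * w) {e : ℚ} (he : W.twoTorsionPolynomial.toPoly.IsRoot e) :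
    ¬ (2 : ℤ) ∣ D.c :=
  not_two_dvd_maninConstant_of_periodLatticeGamma1_eq_of_CDT hCDT W D ⟨q ^ k, hN⟩ hopt he
    (periodLatticeGamma1_eq_of_four_mul_prime_pow hq hq3 hk hN D)

end Summit.BirchSwinnertonDyer.BirchSwinnertonDyer.Theorems.ManinLocalTwoThree.UDCTwo

end
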